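import Literature.Topology.FourManifolds.SliceKnotsFoxMilnorMetabolizer
import HarnessLib

/-!
# Fox–Milnor: metabolizers of the Seifert form — abstract and rational shapes

Sibling proof file of `Literature/Topology/FourManifolds/SliceKnots.lean`, continuing
`SliceKnotsFoxMilnorProofs.lean` (algebraic half of Fox–Milnor (1966), Thm. 2: metabolic block
matrix ⇒ `det (V − tVᵀ) = u · f · f(t⁻¹)` ⇒ every Alexander polynomial of the knot is
`u · f · f(t⁻¹)`) and `SliceKnotsFoxMilnorMetabolizer.lean` (a metabolizer `U ≤ ℤⁿ` — a subgroup of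
half rank on which `vᵀ V w` vanishes — gives the block form, by Smith normal form), for the named
facts `Literature.Topology.FourManifolds.exists_eq_mul_invert_of_isTopologicallySlice` and
`Literature.Topology.FourManifolds.exists_eq_mul_invert_of_isSmoothlySlice`.

The geometric half of the printed proofs produces the metabolizer in one of two shapes, neither of
which is literally a subgroup of `ℤⁿ`:

* **abstract** — the Seifert form is a bilinear form `β` on the free abelian group `H = H₁(F; ℤ)`
  of a Seifert surface `F` (Rolfsen (1976), §8.C; Livingston (2005), §2.2), the Seifert matrix is
  its matrix `(β(bᵢ, bⱼ))ᵢⱼ = LinearMap.toMatrix₂ b b β` in a basis `b`, and the metabolizer is the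
  subgroup `L = ker (H₁(F) → H₁(R))` of `H` (`R ⊆ B⁴` a `3`-manifold with `∂R = F ∪ D`, `D` the
  slice disc), of half rank, on which `β` vanishes (Livingston (2005), proof of Thm. 2.6);
* **rational** — "half lives, half dies" (Kauffman (1987), Ch. VIII, Lemma 8.1) is a statement of
  Poincaré–Lefschetz duality with field coefficients: the kernel of `H₁(F; ℚ) → H₁(R; ℚ)` is a
  subspace `W ≤ ℚ^{2g}` of dimension `g` on which the rationalised Seifert form vanishes
  (Kauffman, Thm. 8.2).

This file proves the passage from either shape to the metabolizer of
`SliceKnotsFoxMilnorMetabolizer.lean`, and restates the knot-level algebraic half accordingly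
(theorems only; no definition, no named fact, no `sorry`):

* `FoxMilnor.repr_dotProduct_toMatrix₂_mulVec_repr` —
  `(b.repr x)ᵀ (β(bᵢ, bⱼ))ᵢⱼ (b.repr y) = β x y`;
* `FoxMilnor.exists_isUnit_det_transpose_mul_toMatrix₂_mul_eq_reindex_fromBlocks` — abstract
  shape ⇒ block form of `LinearMap.toMatrix₂ b b β`;
* `FoxMilnor.finrank_comap_compLeft_eq_finrank` — for a subspace `W ≤ ℚ^ι`, the subgroup
  `W ∩ ℤ^ι ≤ ℤ^ι` has rank `dim W` (integer vectors are `ℤ`-independent iff `ℚ`-independent,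
  Mathlib `LinearIndependent.iff_fractionRing`; denominators of a basis of `W` can be cleared);
* `FoxMilnor.exists_isUnit_det_transpose_mul_mul_eq_reindex_fromBlocks_rat` — rational shape ⇒
  block form over `ℤ`;
* `Knot.exists_eq_mul_invert_of_seifertForm_presentation`,
  `Knot.exists_eq_mul_invert_of_rat_seifert_presentation` — the knot-level algebraic half
  (`Knot.exists_eq_mul_invert_of_seifert_presentation`) with the metabolizer in the abstract,
  resp. rational, shape.

What remains for the two named facts is thus exactly the geometric half: (i) a Seifert surface `F`
of `K` whose Seifert form presents the Alexander module of the knot group by `V − tVᵀ` (infinite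
cyclic cover; Rolfsen (1976), §8.C), and (ii) for `K` bounding a (flat) disc, a half-rank subgroup
of `H₁(F; ℤ)`, or a half-dimensional subspace of `H₁(F; ℚ)`, on which the Seifert form vanishes
(Kauffman (1987), Thm. 8.2; Livingston (2005), Thm. 2.6, with §6 for the locally flat category).

## References

* R. H. Fox, J. W. Milnor, *Singularities of 2-spheres in 4-space and cobordism of knots*, Osaka
  J. Math. 3 (1966), 257–267, Thm. 2. [FoxMilnor1966]
* L. H. Kauffman, *On Knots*, Ann. of Math. Studies 115 (1987), Ch. VIII, Lemma 8.1, Thm. 8.2,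
  Thm. 8.3. [Kauffman1987]
* C. Livingston, *A survey of classical knot concordance*, Handbook of Knot Theory (2005), §2.2,
  Def. 2.5, Thm. 2.6, §3.3, §6 (arXiv math/0307077). [Livingston2005]
* D. Rolfsen, *Knots and Links* (1976), §8.C. [Rolfsen1976]

## Design notes

* The inclusion `ℤ^ι → ℚ^ι` is Mathlib's `ℤ`-linear map `(Algebra.linearMap ℤ ℚ).compLeft ι`; the
  subgroup `W ∩ ℤ^ι` is `(W.restrictScalars ℤ).comap ((Algebra.linearMap ℤ ℚ).compLeft ι)`.
* `Module ℤ ↥L` has two instances (`Submodule.module`, `AddCommGroup.toIntModule`); hypotheses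
  `2 * Module.finrank ℤ L = n` elaborated with either are interchangeable by `Subsingleton.elim`,
  which is how they are consumed below.
-/

open scoped LaurentPolynomial
open Function Set Matrix LaurentPolynomial Module

noncomputable section

namespace Literature.Topology.FourManifolds

namespace FoxMilnor

/-! ## Abstract shape: bilinear forms on free abelian groups -/

section BilinForm

/-- The form `vᵀ V w` of the matrix `V = (β(bᵢ, bⱼ))ᵢⱼ` of a bilinear form `β` in a basis `b`,
evaluated on coordinate vectors, is `β`. [folklore] -/
theorem repr_dotProduct_toMatrix₂_mulVec_repr {R H ι : Type*} [CommRing R] [AddCommGroup H]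
    [Module R H] [Fintype ι] [DecidableEq ι] (b : Basis ι R H) (β : H →ₗ[R] H →ₗ[R] R) (x y : H) :
    ⇑(b.repr x) ⬝ᵥ (LinearMap.toMatrix₂ b b β *ᵥ ⇑(b.repr y)) = β x y := by
  conv_rhs => rw [← (LinearMap.toMatrix₂ b b).symm_apply_apply β, LinearMap.toMatrix₂_symm,
    Matrix.toLinearMap₂_apply]
  simp only [dotProduct, Matrix.mulVec, smul_eq_mul, Finset.mul_sum]
  refine Finset.sum_congr rfl fun i _ ↦ Finset.sum_congr rfl fun j _ ↦ ?_
  ring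

variable {H ι : Type*} [AddCommGroup H] [Module ℤ H] [Fintype ι] [DecidableEq ι]

/-- A subgroup `L ≤ H` on which `β` vanishes is carried by the coordinates of a basis `b` to a
subgroup of `ℤ^ι` on which the form of the matrix of `β` vanishes. [folklore] -/
theorem isotropic_map_equivFun (b : Basis ι ℤ H) (β : H →ₗ[ℤ] H →ₗ[ℤ] ℤ) (L : Submodule ℤ H)
    (hβ : ∀ x ∈ L, ∀ y ∈ L, β x y = 0) :
    ∀ u ∈ L.map (b.equivFun : H →ₗ[ℤ] ι → ℤ), ∀ w ∈ L.map (b.equivFun : H →ₗ[ℤ] ι → ℤ),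
      u ⬝ᵥ (LinearMap.toMatrix₂ b b β *ᵥ w) = 0 := by
  rintro _ ⟨x, hx, rfl⟩ _ ⟨y, hy, rfl⟩
  rw [LinearEquiv.coe_coe, Module.Basis.equivFun_apply, Module.Basis.equivFun_apply,
    repr_dotProduct_toMatrix₂_mulVec_repr]
  exact hβ x hx y hy

omit [DecidableEq ι] in
/-- Coordinates preserve the rank of a subgroup (stated with the `Submodule.module` instance on
the target, whatever instance the hypothesis was elaborated with). [folklore] -/
theorem finrank_map_equivFun (b : Basis ι ℤ H) (L : Submodule ℤ H) {r : ℕ}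
    (hL : Module.finrank ℤ L = r) :
    Module.finrank ℤ (L.map (b.equivFun : H →ₗ[ℤ] ι → ℤ)) = r := by
  rw [LinearEquiv.finrank_map_eq]
  convert hL using 2
  exact Subsingleton.elim _ _

/-- **A metabolizer of a bilinear form gives the metabolic block form of its matrix** (the shape
in which duality delivers it: `H = H₁(F; ℤ)` free of rank `2g` with the Seifert form `β`, and `L`
the kernel of `H₁(F) → H₁(R)`, Livingston (2005), proof of Thm. 2.6). If `β` vanishes on a
subgroup `L ≤ H` with `2 · rank L = n = rank H`, then the matrix of `β` in any basis
`b : Fin n → H` is unimodularly congruent, after reindexing, to a block matrix `(0 A; B D)` with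
square blocks of equal size. From
`FoxMilnor.exists_isUnit_det_transpose_mul_mul_eq_reindex_fromBlocks`.
[cite: Livingston2005, Def. 2.5 and Thm. 2.6] -/
theorem exists_isUnit_det_transpose_mul_toMatrix₂_mul_eq_reindex_fromBlocks {n : ℕ}
    (b : Basis (Fin n) ℤ H) (β : H →ₗ[ℤ] H →ₗ[ℤ] ℤ) (L : Submodule ℤ H)
    (hL : 2 * Module.finrank ℤ L = n) (hβ : ∀ x ∈ L, ∀ y ∈ L, β x y = 0) :
    ∃ (k : ℕ) (σ : Fin k ⊕ Fin k ≃ Fin n) (Q : Matrix (Fin n) (Fin n) ℤ)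
      (A B D : Matrix (Fin k) (Fin k) ℤ),
      IsUnit Q.det ∧ Qᵀ * LinearMap.toMatrix₂ b b β * Q = reindex σ σ (fromBlocks 0 A B D) :=
  exists_isUnit_det_transpose_mul_mul_eq_reindex_fromBlocks _ (L.map (b.equivFun : H →ₗ[ℤ] _))
    (by rw [finrank_map_equivFun b L rfl]; convert hL using 2)
    (isotropic_map_equivFun b β L hβ)

end BilinForm

/-! ## Rational shape: subspaces of `ℚ^ι` and the lattice `W ∩ ℤ^ι` -/

section Rational

/-- The inclusion `ℤ^ι → ℚ^ι` is the coordinatewise cast. [folklore] -/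
theorem compLeft_algebraLinearMap_apply {ι : Type*} (x : ι → ℤ) (i : ι) :
    (Algebra.linearMap ℤ ℚ).compLeft ι x i = (x i : ℚ) := rfl

/-- The inclusion `ℤ^ι → ℚ^ι` is postcomposition with `Int.castRingHom ℚ`. [folklore] -/
theorem compLeft_algebraLinearMap_eq_comp {ι : Type*} (x : ι → ℤ) :
    (Algebra.linearMap ℤ ℚ).compLeft ι x = ⇑(Int.castRingHom ℚ) ∘ x := rfl

/-- `ℤ^ι → ℚ^ι` is injective. [folklore] -/
theorem ker_compLeft_algebraLinearMap (ι : Type*) :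
    LinearMap.ker ((Algebra.linearMap ℤ ℚ).compLeft ι) = ⊥ := by
  rw [LinearMap.ker_eq_bot']
  intro x hx
  ext i
  have := congrFun hx i
  simpa [compLeft_algebraLinearMap_apply] using this

/-- The integral form `vᵀ V w` is the rational one on integer vectors. [folklore] -/
theorem cast_dotProduct_mulVec {ι : Type*} [Fintype ι] (V : Matrix ι ι ℤ) (x y : ι → ℤ) :
    ((x ⬝ᵥ (V *ᵥ y) : ℤ) : ℚ) = (Algebra.linearMap ℤ ℚ).compLeft ι x ⬝ᵥ
      (V.map ((↑) : ℤ → ℚ) *ᵥ (Algebra.linearMap ℤ ℚ).compLeft ι y) := by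
  rw [← eq_intCast (Int.castRingHom ℚ), RingHom.map_dotProduct, compLeft_algebraLinearMap_eq_comp,
    compLeft_algebraLinearMap_eq_comp]
  congr 1
  ext i
  exact RingHom.map_mulVec _ _ _ _

/-- A subspace `W ≤ ℚ^ι` on which the rational form of an integer matrix `V` vanishes meets `ℤ^ι`
in a subgroup on which the integral form vanishes. [folklore] -/
theorem isotropic_comap_compLeft {ι : Type*} [Fintype ι] (V : Matrix ι ι ℤ)
    (W : Submodule ℚ (ι → ℚ)) (hV : ∀ x ∈ W, ∀ y ∈ W, x ⬝ᵥ (V.map ((↑) : ℤ → ℚ) *ᵥ y) = 0) :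
    ∀ u ∈ (W.restrictScalars ℤ).comap ((Algebra.linearMap ℤ ℚ).compLeft ι),
      ∀ w ∈ (W.restrictScalars ℤ).comap ((Algebra.linearMap ℤ ℚ).compLeft ι),
        u ⬝ᵥ (V *ᵥ w) = 0 := by
  intro x hx y hy
  have h := hV _ hx _ hy
  rw [← cast_dotProduct_mulVec] at h
  exact_mod_cast h

/-- **Integral points of a rational subspace form a subgroup of the same rank**: for a subspace
`W ≤ ℚ^ι`, the subgroup `W ∩ ℤ^ι` of `ℤ^ι` has rank `dim W` (a `ℤ`-basis of `W ∩ ℤ^ι` stays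
`ℚ`-independent; a `ℚ`-basis of `W` with denominators cleared is a `ℤ`-independent family in
`W ∩ ℤ^ι`; Mathlib `LinearIndependent.iff_fractionRing`). [folklore] -/
theorem finrank_comap_compLeft_eq_finrank {ι : Type*} [Fintype ι] (W : Submodule ℚ (ι → ℚ)) :
    Module.finrank ℤ ((W.restrictScalars ℤ).comap ((Algebra.linearMap ℤ ℚ).compLeft ι)) =
      Module.finrank ℚ W := by
  classical
  set φ := (Algebra.linearMap ℤ ℚ).compLeft ι with hφ
  set N := (W.restrictScalars ℤ).comap φ with hN
  apply le_antisymm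
  · -- a `ℤ`-basis of `N` is `ℚ`-independent in `W`
    set s := Module.finrank ℤ N
    let c := Module.finBasis ℤ N
    have h1 : LinearIndependent ℤ (⇑φ ∘ ⇑N.subtype ∘ ⇑c) :=
      (c.linearIndependent.map' N.subtype (Submodule.ker_subtype N)).map' _
        (ker_compLeft_algebraLinearMap ι)
    have h2 : LinearIndependent ℚ (⇑φ ∘ ⇑N.subtype ∘ ⇑c) :=
      (LinearIndependent.iff_fractionRing ℤ ℚ).mp h1
    let v : Fin s → W := fun k ↦ ⟨φ (c k), (c k).2⟩
    have h3 : LinearIndependent ℚ v := LinearIndependent.of_comp W.subtype h2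
    simpa using h3.fintype_card_le_finrank
  · -- clear denominators of a `ℚ`-basis of `W`
    set r := Module.finrank ℚ W
    let w := Module.finBasis ℚ W
    obtain ⟨d, hd⟩ := IsLocalization.exist_integer_multiples_of_finite (nonZeroDivisors ℤ)
      (fun p : Fin r × ι ↦ (w p.1 : ι → ℚ) p.2)
    choose z hz using hd
    have hz' : ∀ k i, (z (k, i) : ℚ) = ((d : ℤ) : ℚ) * (w k : ι → ℚ) i := fun k i ↦ by
      have := hz (k, i)
      simp only [zsmul_eq_mul, eq_intCast] at this
      exact this
    -- `m k` is the integer vector `d • w k`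
    let m : Fin r → N := fun k ↦ ⟨fun i ↦ z (k, i), by
      have heq : φ (fun i ↦ z (k, i)) = ((d : ℤ) : ℚ) • (w k : ι → ℚ) := by
        ext i
        simp only [hφ, compLeft_algebraLinearMap_apply, Pi.smul_apply, smul_eq_mul]
        exact hz' k i
      show φ _ ∈ W
      rw [heq]
      exact W.smul_mem _ (w k).2⟩
    have hd0 : ((d : ℤ) : ℚ) ≠ 0 := by exact_mod_cast nonZeroDivisors.coe_ne_zero d
    have hm : ⇑φ ∘ ⇑N.subtype ∘ m = fun k ↦ ((d : ℤ) : ℚ) • W.subtype (w k) := by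
      ext k i
      simp only [Function.comp_apply, Submodule.coe_subtype, Pi.smul_apply, smul_eq_mul]
      exact hz' k i
    have h1 : LinearIndependent ℚ (fun k ↦ ((d : ℤ) : ℚ) • W.subtype (w k)) := by
      have hw : LinearIndependent ℚ (⇑W.subtype ∘ ⇑w) :=
        w.linearIndependent.map' W.subtype (Submodule.ker_subtype W)
      convert hw.units_smul fun _ ↦ Units.mk0 _ hd0 using 1
      ext k i
      simp [Units.smul_def]
    have h2 : LinearIndependent ℤ (⇑φ ∘ ⇑N.subtype ∘ m) := by
      rw [hm]
      exact (LinearIndependent.iff_fractionRing ℤ ℚ).mpr h1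
    have h3 : LinearIndependent ℤ m :=
      LinearIndependent.of_comp _ (LinearIndependent.of_comp _ h2)
    simpa using h3.fintype_card_le_finrank

/-- **A rational metabolizer gives the metabolic block form over `ℤ`.** If `V` is an integer
`n × n` matrix and `W ≤ ℚⁿ` a subspace with `2 · dim W = n` on which the rational form `vᵀ V w`
vanishes (the shape in which Poincaré–Lefschetz duality with field coefficients delivers the kernel
of `H₁(F; ℚ) → H₁(R; ℚ)`: Kauffman (1987), Ch. VIII, Lemma 8.1 and Thm. 8.2), then `V` is
unimodularly congruent over `ℤ`, after reindexing, to a block matrix `(0 A; B D)` with square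
blocks of equal size: `W ∩ ℤⁿ` is a metabolizer in the sense of
`FoxMilnor.exists_isUnit_det_transpose_mul_mul_eq_reindex_fromBlocks`
(`finrank_comap_compLeft_eq_finrank`, `isotropic_comap_compLeft`).
[cite: Kauffman1987, Ch. VIII Lemma 8.1 and Thm. 8.2]
[cite: Livingston2005, Def. 2.5 and Thm. 2.6] -/
theorem exists_isUnit_det_transpose_mul_mul_eq_reindex_fromBlocks_rat {n : ℕ}
    (V : Matrix (Fin n) (Fin n) ℤ) (W : Submodule ℚ (Fin n → ℚ))
    (hW : 2 * Module.finrank ℚ W = n)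
    (hV : ∀ x ∈ W, ∀ y ∈ W, x ⬝ᵥ (V.map ((↑) : ℤ → ℚ) *ᵥ y) = 0) :
    ∃ (k : ℕ) (σ : Fin k ⊕ Fin k ≃ Fin n) (Q : Matrix (Fin n) (Fin n) ℤ)
      (A B D : Matrix (Fin k) (Fin k) ℤ),
      IsUnit Q.det ∧ Qᵀ * V * Q = reindex σ σ (fromBlocks 0 A B D) :=
  exists_isUnit_det_transpose_mul_mul_eq_reindex_fromBlocks V _
    (by rw [finrank_comap_compLeft_eq_finrank]; exact hW) (isotropic_comap_compLeft V W hV)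

end Rational

end FoxMilnor

/-! ## The knot-level algebraic half with an abstract or rational metabolizer -/

namespace Knot

open FoxMilnor

/-- **Fox–Milnor, algebraic half, Seifert-form shape.** As
`Knot.exists_eq_mul_invert_of_seifert_presentation`, with the Seifert matrix given as the matrix
`(β(bᵢ, bⱼ))ᵢⱼ` of a bilinear form `β` on a free abelian group `H` in a basis `b` (the Seifert form
on `H = H₁(F; ℤ)`: Rolfsen (1976), §8.C; Livingston (2005), §2.2) and the metabolizer given as a
subgroup `L ≤ H` of half rank on which `β` vanishes (Livingston, proof of Thm. 2.6: the kernel of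
`H₁(F) → H₁(R)`). [cite: Livingston2005, Thm. 2.6 and §3.3] [cite: FoxMilnor1966, Thm. 2] -/
theorem exists_eq_mul_invert_of_seifertForm_presentation (K : Knot) (x : K.complement)
    (e : Abelianization (K.group x) ≃* Multiplicative ℤ) {n : ℕ}
    (π : (Fin n → MonoidAlgebra ℤ (Abelianization (K.group x))) →ₗ[MonoidAlgebra ℤ
      (Abelianization (K.group x))] alexanderModule (K.group x))
    (hπ : Function.Surjective π) {H : Type*} [AddCommGroup H] [Module ℤ H]
    (b : Basis (Fin n) ℤ H) (β : H →ₗ[ℤ] H →ₗ[ℤ] ℤ)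
    (hker : LinearMap.ker π = Submodule.span (MonoidAlgebra ℤ (Abelianization (K.group x)))
      (Set.range (((LinearMap.toMatrix₂ b b β).map (C : ℤ →+* ℤ[T;T⁻¹]) -
        (T 1 : ℤ[T;T⁻¹]) • ((LinearMap.toMatrix₂ b b β).map (C : ℤ →+* ℤ[T;T⁻¹]))ᵀ).map
          (laurentEquivOfMulEquiv (K.group x) e).symm)))
    (L : Submodule ℤ H) (hL : 2 * Module.finrank ℤ L = n) (hβ : ∀ a ∈ L, ∀ c ∈ L, β a c = 0)
    {Δ : ℤ[T;T⁻¹]} (hΔ : K.IsAlexanderPolynomial Δ) :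
    ∃ (f : ℤ[T;T⁻¹]) (u : ℤ[T;T⁻¹]ˣ), Δ = ↑u * f * LaurentPolynomial.invert f :=
  K.exists_eq_mul_invert_of_seifert_presentation x e π hπ _ hker (L.map (b.equivFun : H →ₗ[ℤ] _))
    (by rw [finrank_map_equivFun b L rfl]; convert hL using 2)
    (isotropic_map_equivFun b β L hβ) hΔ

/-- **Fox–Milnor, algebraic half, rational metabolizer** (field coefficients, as in Kauffman
(1987), Ch. VIII, Lemma 8.1 and Thm. 8.2). As `Knot.exists_eq_mul_invert_of_seifert_presentation`,
with the metabolizer given as a subspace `W ≤ ℚⁿ` of half dimension on which the rational form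
`vᵀ V w` of the Seifert matrix `V` vanishes. [cite: Kauffman1987, Ch. VIII Thm. 8.2–8.3]
[cite: FoxMilnor1966, Thm. 2] -/
theorem exists_eq_mul_invert_of_rat_seifert_presentation (K : Knot) (x : K.complement)
    (e : Abelianization (K.group x) ≃* Multiplicative ℤ) {n : ℕ}
    (π : (Fin n → MonoidAlgebra ℤ (Abelianization (K.group x))) →ₗ[MonoidAlgebra ℤ
      (Abelianization (K.group x))] alexanderModule (K.group x))
    (hπ : Function.Surjective π) (V : Matrix (Fin n) (Fin n) ℤ)
    (hker : LinearMap.ker π = Submodule.span (MonoidAlgebra ℤ (Abelianization (K.group x)))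
      (Set.range ((V.map (C : ℤ →+* ℤ[T;T⁻¹]) -
        (T 1 : ℤ[T;T⁻¹]) • (V.map (C : ℤ →+* ℤ[T;T⁻¹]))ᵀ).map
          (laurentEquivOfMulEquiv (K.group x) e).symm)))
    (W : Submodule ℚ (Fin n → ℚ)) (hW : 2 * Module.finrank ℚ W = n)
    (hVW : ∀ v ∈ W, ∀ w ∈ W, v ⬝ᵥ (V.map ((↑) : ℤ → ℚ) *ᵥ w) = 0)
    {Δ : ℤ[T;T⁻¹]} (hΔ : K.IsAlexanderPolynomial Δ) :
    ∃ (f : ℤ[T;T⁻¹]) (u : ℤ[T;T⁻¹]ˣ), Δ = ↑u * f * LaurentPolynomial.invert f :=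
  K.exists_eq_mul_invert_of_seifert_presentation x e π hπ V hker _
    (by rw [finrank_comap_compLeft_eq_finrank]; exact hW) (isotropic_comap_compLeft V W hVW) hΔ

end Knot

end Literature.Topology.FourManifolds
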